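import Literature.Topology.FourManifolds.TrisectionStabilizationDatumSphere
import HarnessLib

/-!
# (d′) from one geometric stabilisation step in joint-chart datum form: the assembly

Topic `Literature/Topology/FourManifolds`; fact seat
`provefact-Literature.Topology.FourManifolds.sphere-99d675ea90` (named fact (d′)
`Literature.Topology.FourManifolds.sphere_gkTrisections`).  Everything in this file is **proved**;
there are no definitions and no named facts.

`TrisectionStabilizationDatum.lean` proves (d′) from any invariant `Good` of marked balanced
trisections of the round `S⁴` that holds at genus `0` and is carried, together with the
on-the-nose identity `𝒢(S′, x₀′, μ′) = 𝒢(S, x₀, μ).stabilize`, through one stabilisation step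
(`sphere_gkTrisections_of_invariant_step`); `TrisectionStabilizationDatumSphere.lean` supplies the
genus-`0` instance of the natural invariant — **the joint-chart datum**: a joint chart `Θ` of the
trisection (all three sectors linear in the normal plane, the central surface `F = {q₀ = q₁ = 0}`;
Gay–Kirby's Fig. 1), the cell `Φ(z) = Θ⁻¹(0, 0, ρ z)` on `B̄(0, 2) ⊂ ℝ²`, and a free basis `θ_A`
of `π₁(F ∖ Φ(B(0,1)), x₀)`, `x₀ = Φ(1, 0)`, with `θ_A(r_g) = [∂]` and `μ ∘ mk = (A ⊆ F)_* ∘ θ_A`.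

This file performs the assembly: `sphere_gkTrisections_of_jointChartDatum_step` — **(d′) holds as
soon as every marked balanced `(g, k)`-trisection of `S⁴` carrying a joint-chart datum admits a
marked balanced `(g + 3, k + 1)`-trisection of `S⁴` carrying a joint-chart datum, with kernel
triple the algebraic stabilisation ON THE NOSE** (Gay–Kirby 2016, Lemma 10, performed inside the
chart box around the datum disc; Abrams–Gay–Kirby 2018, Thm. 5; its `π₁` stage is
`exists_marking_groupGKTrisectionOf_eq_stabilize_datum`, its old-handlebody inputs are
`IsGKTrisection.surjective_inclHomOfSubset_diff_image_ball_bite` and the bite lemmas of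
`TrisectionStabilizationBite.lean`).  The hypothesis `step` is thus the one remaining geometric
statement between the tree and (d′); it is spelled out in full, twice (as hypothesis and as
conclusion of the step), because the tree keeps no auxiliary definitions for it.

## References

* D. Gay, R. Kirby, *Trisecting 4-manifolds*, Geom. Topol. 20 (2016) 3097–3132
  (arXiv:1205.1565): §2 (arXiv p. 5: the trisections of `S⁴`), Def. 8 and Lemma 10 (p. 3100).
  [GayKirby2016]
* A. Abrams, D. Gay, R. Kirby, *Group trisections and smooth 4-manifolds*, Geom. Topol. 22
  (2018) 1537–1545: Thm. 5 (p. 1541). [AbramsGayKirby2018]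
-/

noncomputable section

open Set Metric Function
open Literature.AlgebraicTopology.FundamentalGroup
open Literature.AlgebraicTopology.FundamentalGroup.VanKampen
open scoped Manifold ContDiff

namespace Literature.Topology.FourManifolds

/-- **(d′) from the geometric stabilisation step in joint-chart datum form.**  Write
`JCD(g, k, S, x₀, μ)` ("the marking `μ` reads through a joint-chart datum") for: there are a chart
`Θ` of the maximal `C^∞` atlas of `S⁴`, indices `i, j, l` and `ρ > 0`, a cell
`Φ : B̄(0,2) ⊂ ℝ² → S⁴` and an open `O` such that — `S i = {q₀ ≥ 0, q₁ ≥ 0}`,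
`F = ⋂ S = {q₀ = q₁ = 0}`, `S j = {q₀ ≤ 0, q₀ ≤ q₁}`, `S l = {q₁ ≤ 0, q₁ ≤ q₀}` on `Θ.source`;
`Φ(B̄(0,2)) ⊆ Θ.source`, `Θ(Φ z) = (0, 0, ρ z)`, `Φ` injective, `Φ(B̄(0,2)) ⊆ F`, `O ⊆ Θ.source`
open, `O = {‖(Θ y)₂₃‖ < 2ρ}`, `F ∩ O = Φ(B(0,2))`; `x₀ = Φ(1, 0)`; `A = F ∖ Φ(B(0,1))` is path
connected; and for `C = Φ(S¹) ∋ x₀`, `C ⊆ A ⊆ F`, there are a generator `t` of `π₁(C, x₀)` and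
`θ_A : F⟨a₁,…,b_g⟩ ≃* π₁(A, x₀)` with `θ_A(r_g) = (C ⊆ A)_* t` and `μ ∘ mk = (A ⊆ F)_* ∘ θ_A`.
If every marked balanced `(g, k)`-trisection of the round `S⁴` with `JCD` admits a marked balanced
`(g+3, k+1)`-trisection with `JCD` whose kernel triple is `(𝒢(h, x₀, μ)).stabilize` on the nose
(Gay–Kirby's stabilisation inside the chart box, Lemma 10, with Abrams–Gay–Kirby's Thm. 5), then
(d′) `sphere_gkTrisections` holds: the base `JCD(0, 0, sphereSector, Φ(1,0), μ₀)` is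
`GayKirby.sphereSector_exists_jointChart_datum`, and `sphere_gkTrisections_of_invariant_step`
iterates. [cite: GayKirby2016, §2 (arXiv p. 5) and Lemma 10 (p. 3100)]
[cite: AbramsGayKirby2018, Thm. 5 (p. 1541)] -/
theorem sphere_gkTrisections_of_jointChartDatum_step
    (step : ∀ (g k : ℕ) (S : Fin 3 → Set (Metric.sphere (0 : EuclideanSpace ℝ (Fin 5)) 1))
      (h : IsBalancedGKTrisection (Metric.sphere (0 : EuclideanSpace ℝ (Fin 5)) 1) g k S)
      (x₀ : centralSurface S)
      (μ : SurfaceGroup g ≃* _root_.FundamentalGroup (centralSurface S) x₀),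
      (∃ (Θ : OpenPartialHomeomorph (Metric.sphere (0 : EuclideanSpace ℝ (Fin 5)) 1)
          (EuclideanSpace ℝ (Fin 4))) (i j l : Fin 3) (ρ : ℝ)
        (Φ : C(closedBall (0 : EuclideanSpace ℝ (Fin 2)) 2, Metric.sphere (0 : EuclideanSpace ℝ (Fin 5)) 1))
        (O : Set (Metric.sphere (0 : EuclideanSpace ℝ (Fin 5)) 1)),
        Θ ∈ IsManifold.maximalAtlas (𝓡 4) ∞ (Metric.sphere (0 : EuclideanSpace ℝ (Fin 5)) 1) ∧
        j ≠ i ∧ l ≠ i ∧ l ≠ j ∧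
        (∀ y ∈ Θ.source, y ∈ S i ↔ (0 ≤ Θ y 0 ∧ 0 ≤ Θ y 1)) ∧
        (∀ y ∈ Θ.source, y ∈ (⋂ m, S m) ↔ (Θ y 0 = 0 ∧ Θ y 1 = 0)) ∧
        (∀ y ∈ Θ.source, y ∈ S j ↔ (Θ y 0 ≤ 0 ∧ Θ y 0 ≤ Θ y 1)) ∧
        (∀ y ∈ Θ.source, y ∈ S l ↔ (Θ y 1 ≤ 0 ∧ Θ y 1 ≤ Θ y 0)) ∧
        0 < ρ ∧ (∀ z, Φ z ∈ Θ.source) ∧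
        (∀ z, Θ (Φ z) =
          !₂[0, 0, ρ * (z : EuclideanSpace ℝ (Fin 2)) 0, ρ * (z : EuclideanSpace ℝ (Fin 2)) 1]) ∧
        Injective Φ ∧ range Φ ⊆ (⋂ m, S m) ∧ IsOpen O ∧ O ⊆ Θ.source ∧
        O = {y | y ∈ Θ.source ∧ ‖(!₂[Θ y 2, Θ y 3] : EuclideanSpace ℝ (Fin 2))‖ < 2 * ρ} ∧
        (⋂ m, S m) ∩ O = Φ '' {z | ‖(z : EuclideanSpace ℝ (Fin 2))‖ < 2} ∧
        (x₀ : Metric.sphere (0 : EuclideanSpace ℝ (Fin 5)) 1) =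
          Φ ⟨Complex.orthonormalBasisOneI.repr 1, closedBall_subset_closedBall one_le_two (by simp)⟩ ∧
        IsPathConnected ((⋂ m, S m) \ Φ '' {z | ‖(z : EuclideanSpace ℝ (Fin 2))‖ < 1}) ∧
        ∃ (hx₀C : (x₀ : Metric.sphere (0 : EuclideanSpace ℝ (Fin 5)) 1) ∈
              Φ '' {z | ‖(z : EuclideanSpace ℝ (Fin 2))‖ = 1})
          (hCA : Φ '' {z | ‖(z : EuclideanSpace ℝ (Fin 2))‖ = 1} ⊆
            (⋂ m, S m) \ Φ '' {z | ‖(z : EuclideanSpace ℝ (Fin 2))‖ < 1})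
          (hAF : (⋂ m, S m) \ Φ '' {z | ‖(z : EuclideanSpace ℝ (Fin 2))‖ < 1} ⊆ ⋂ m, S m)
          (t : _root_.FundamentalGroup ↥(Φ '' {z | ‖(z : EuclideanSpace ℝ (Fin 2))‖ = 1}) ⟨_, hx₀C⟩)
          (θA : FreeGroup (surfaceGen g) ≃*
            _root_.FundamentalGroup ↥((⋂ m, S m) \ Φ '' {z | ‖(z : EuclideanSpace ℝ (Fin 2))‖ < 1})
              ⟨_, hCA hx₀C⟩),
          Subgroup.closure {t} = ⊤ ∧
          θA (surfaceRelator g) = inclHomOfSubset hCA _ hx₀C (hCA hx₀C) t ∧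
          μ.toMonoidHom.comp (PresentedGroup.mk _) =
            (inclHomOfSubset hAF _ (hCA hx₀C) (hAF (hCA hx₀C))).comp θA.toMonoidHom) →
      ∃ (S' : Fin 3 → Set (Metric.sphere (0 : EuclideanSpace ℝ (Fin 5)) 1))
        (h' : IsBalancedGKTrisection (Metric.sphere (0 : EuclideanSpace ℝ (Fin 5)) 1)
          (g + 3) (k + 1) S')
        (x₀' : centralSurface S')
        (μ' : SurfaceGroup (g + 3) ≃* _root_.FundamentalGroup (centralSurface S') x₀'),
        (∃ (Θ : OpenPartialHomeomorph (Metric.sphere (0 : EuclideanSpace ℝ (Fin 5)) 1)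
            (EuclideanSpace ℝ (Fin 4))) (i j l : Fin 3) (ρ : ℝ)
          (Φ : C(closedBall (0 : EuclideanSpace ℝ (Fin 2)) 2, Metric.sphere (0 : EuclideanSpace ℝ (Fin 5)) 1))
          (O : Set (Metric.sphere (0 : EuclideanSpace ℝ (Fin 5)) 1)),
          Θ ∈ IsManifold.maximalAtlas (𝓡 4) ∞ (Metric.sphere (0 : EuclideanSpace ℝ (Fin 5)) 1) ∧
          j ≠ i ∧ l ≠ i ∧ l ≠ j ∧
          (∀ y ∈ Θ.source, y ∈ S' i ↔ (0 ≤ Θ y 0 ∧ 0 ≤ Θ y 1)) ∧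
          (∀ y ∈ Θ.source, y ∈ (⋂ m, S' m) ↔ (Θ y 0 = 0 ∧ Θ y 1 = 0)) ∧
          (∀ y ∈ Θ.source, y ∈ S' j ↔ (Θ y 0 ≤ 0 ∧ Θ y 0 ≤ Θ y 1)) ∧
          (∀ y ∈ Θ.source, y ∈ S' l ↔ (Θ y 1 ≤ 0 ∧ Θ y 1 ≤ Θ y 0)) ∧
          0 < ρ ∧ (∀ z, Φ z ∈ Θ.source) ∧
          (∀ z, Θ (Φ z) =
            !₂[0, 0, ρ * (z : EuclideanSpace ℝ (Fin 2)) 0, ρ * (z : EuclideanSpace ℝ (Fin 2)) 1]) ∧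
          Injective Φ ∧ range Φ ⊆ (⋂ m, S' m) ∧ IsOpen O ∧ O ⊆ Θ.source ∧
          O = {y | y ∈ Θ.source ∧ ‖(!₂[Θ y 2, Θ y 3] : EuclideanSpace ℝ (Fin 2))‖ < 2 * ρ} ∧
          (⋂ m, S' m) ∩ O = Φ '' {z | ‖(z : EuclideanSpace ℝ (Fin 2))‖ < 2} ∧
          (x₀' : Metric.sphere (0 : EuclideanSpace ℝ (Fin 5)) 1) =
            Φ ⟨Complex.orthonormalBasisOneI.repr 1, closedBall_subset_closedBall one_le_two (by simp)⟩ ∧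
          IsPathConnected ((⋂ m, S' m) \ Φ '' {z | ‖(z : EuclideanSpace ℝ (Fin 2))‖ < 1}) ∧
          ∃ (hx₀C : (x₀' : Metric.sphere (0 : EuclideanSpace ℝ (Fin 5)) 1) ∈
                Φ '' {z | ‖(z : EuclideanSpace ℝ (Fin 2))‖ = 1})
            (hCA : Φ '' {z | ‖(z : EuclideanSpace ℝ (Fin 2))‖ = 1} ⊆
              (⋂ m, S' m) \ Φ '' {z | ‖(z : EuclideanSpace ℝ (Fin 2))‖ < 1})
            (hAF : (⋂ m, S' m) \ Φ '' {z | ‖(z : EuclideanSpace ℝ (Fin 2))‖ < 1} ⊆ ⋂ m, S' m)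
            (t : _root_.FundamentalGroup ↥(Φ '' {z | ‖(z : EuclideanSpace ℝ (Fin 2))‖ = 1}) ⟨_, hx₀C⟩)
            (θA : FreeGroup (surfaceGen (g + 3)) ≃*
              _root_.FundamentalGroup ↥((⋂ m, S' m) \ Φ '' {z | ‖(z : EuclideanSpace ℝ (Fin 2))‖ < 1})
                ⟨_, hCA hx₀C⟩),
            Subgroup.closure {t} = ⊤ ∧
            θA (surfaceRelator (g + 3)) = inclHomOfSubset hCA _ hx₀C (hCA hx₀C) t ∧
            μ'.toMonoidHom.comp (PresentedGroup.mk _) =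
              (inclHomOfSubset hAF _ (hCA hx₀C) (hAF (hCA hx₀C))).comp θA.toMonoidHom) ∧
        groupGKTrisectionOf h' x₀' μ' = (groupGKTrisectionOf h x₀ μ).stabilize) :
    sphere_gkTrisections := by
  refine sphere_gkTrisections_of_invariant_step _ ?_ step
  -- the base: Gay–Kirby's genus-`0` trisection of `S⁴` with the joint-chart datum at `e₂`
  have h₀ : IsBalancedGKTrisection (Metric.sphere (0 : EuclideanSpace ℝ (Fin 5)) 1) 0 0
      GayKirby.sphereSector := sphereSector_isBalancedGKTrisection_holds
  obtain ⟨Θ, l, ρ, Φ, O, ⟨hΘ, -, -, hli, hlj, hSi, hF, hSj, hSl, hρ, h1, h2, -, hinj, hΦF, hO,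
    h7, -, h9, hFO⟩, hx₀, hA, hCA, hCAe, hCCA, hsdr, hAsc, hApc, hCpc, hAF, t, θA, μ₀, ht, hθA, hμ⟩ :=
    GayKirby.sphereSector_exists_jointChart_datum (i := 0) (j := 1) (by decide)
      GayKirby.sphereSector_basePoint.2
  exact ⟨GayKirby.sphereSector, h₀, ⟨_, hAF (hCA hx₀)⟩, μ₀, Θ, 0, 1, l, ρ, Φ, O, hΘ, by decide,
    hli, hlj, hSi, hF, hSj, hSl, hρ, h1, h2, hinj, hΦF, hO, h7, h9, hFO, rfl, hApc, hx₀, hCA, hAF,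
    t, θA, ht, hθA, hμ⟩

end Literature.Topology.FourManifolds
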